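import Mathlib
import Literature.MathematicalPhysics.QuantumFieldTheory.Balaban1983to89.B9Eq325Proj

/-! # `Balaban1983to89.B9Eq333Cov` — B9 pp. 395–396, (3.30)–(3.34): gauge covariance of Δ^η_U, Δ′_a, G′, R, Δ_a, G
as kernel-checked INTERTWINING ALGEBRA, and the fibrewise isometry mechanism behind p. 398 "All these inequalities are
invariant with respect to gauge transformations of U"

CITATION HEADER.  Paper sub-cell `b2b-balaban-b09` (gen 6, journal claim SHARPEN T06.6 gauge covariance (3.30)–(3.34)
pass 7 ∕ G-B9-14-COV, cell pub-balaban) on T. Balaban, *Propagators for lattice gauge theories in a background field*,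
Commun. Math. Phys. 99 (1985) 389–434 [`Balaban1985BackgroundPropagators`] (= B9), pp. 395–396 [PDF 7–8] (renders
`b2b-balaban-ref1/pages/1985-cmp99-background-propagators/…-p007-x2.png`, `…-p008-x2.png`, read as images) and the
sentence after (3.47), p. 398 [PDF 10].

WHAT IS PRINTED (verbatim).
* p. 395: *"We define Δ^η_a(U) = Δ^η(U) + D^η_U R(U)D^η\*_U + Q\*(U)aQ(U), (3.26) or simply Δ_a = Δ + DRD\* + Q\*aQ. …
  we denote its inverse again by G, or G(U) … G(U) = G = (Δ_a↾_{Ω₀})^{−1}. (3.27)"* … *"Let us discuss how these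
  operators transform under gauge transformations of the configuration U. … if we make the transformations U → U^u,
  U′ → R(u)U′, (3.28) where U^u(x, x′) = u(x)U(x, x′)u^{−1}(x′), (R(u)U′)(x, x′) = R(u(x))U′(x, x′), then
  A^η(R(u)U′U^u) = A^η((U′U)^u) = A^η(U′U). (3.29) … Taking the polynomials of first and second order we get
  ⟨R(u)A, J^u⟩ = ⟨A, J⟩, ⟨R(u)A, Δ^η(U^u)R(u)A⟩ = ⟨A, Δ^η(U)A⟩, (3.30) or J^u = R(u)J, Δ^η(U^u) = R(u)Δ^η(U)R(u^{−1}).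
  We have a similar situation for the other operators. For the covariant Laplace operator (3.23) we have
  ⟨R(u)λ, Δ^η_{U^u}R(u)λ⟩ = ⟨λ, Δ^η_U λ⟩, hence Δ^η_{U^u} = R(u)Δ^η_U R(u^{−1}). (3.31) The matrices in the definitions
  (3.19) transform as follows R(U^u(Γ^{(j)}_{y,x})) = R(u(y))R(U(Γ^{(j)}_{y,x}))R(u^{−1}(x)), hence
  (Q′_j(U^u)R(u)λ)(y) = R(u(y))(Q′_j(U)λ)(y), (3.32) and Q′\*(U^u)aQ′(U^u) = R(u)Q′\*(U)aQ′(U)R(u^{−1})."*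
* p. 396: *"The equalities (3.31), (3.32) imply further G′(U^u) = R(u)G′(U)R(u^{−1}), R(U^u) = R(u)R(U)R(u^{−1}). (3.33)
  Finally inspecting the definitions of the averaging operators Q_j(U) for gauge fields we can see that the equalities
  (3.32) hold again. This implies the transformation laws for the operators Δ_a and G
  Δ_a(U^u) = R(u)Δ_a(U)R(u^{−1}), G(U^u) = R(u)G(U)R(u^{−1}). (3.34)"*
* p. 398, after (3.47): *"All these inequalities are invariant with respect to gauge transformations of U"*; Cor. 3.6
  proof p. 408: *"we have to recall only that all the results of these theorems are gauge invariant"* (the by-reference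
  leaf `B9.GaugeReduction335`, cell GAPS G-B9-14, certified BY HAND).

TYPING.  As in `B9Eq325Proj` (abstract real inner-product spaces): E ⊇ L²(Ω₀, 𝔤) (scalar 𝔤-valued functions λ),
F = L²(𝔅), E₁ = the 𝔤-valued VECTOR fields A on Ω₀ (where Δ^η(U), Δ_a act), F₁ = the target of the gauge-field
averages Q(U).  The gauge transformation u acts by the linear maps T = R(u) on E, S = R(u(·)) on F ((3.32)), T₁ = R(u)
on E₁, S₁ on F₁.  "X(U^u) = R(u)X(U)R(u^{−1})" is typed in INTERTWINING form X′ ∘ T = T ∘ X (pointwise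
`∀ x, X′ (T x) = T (X x)`; for invertible T this is the printed conjugation, `intertwine_iff_conj`), which keeps
R(u^{−1}) out of every statement and shows exactly which conclusions need R(u) invertible / orthogonal.  Unprimed
operators = at U, primed = at U^u; the two Sect. 3 systems are two `B9Eq325Proj.Data` bundles.

WHAT THIS FILE CERTIFIES (kernel; value = the two printed words "imply" (3.33) and "implies" (3.34) + the mechanism of
the p. 398 sentence made theorems, NOT summit progress).
1. GENERIC (§1): `inverse_intertwine` — if L′T = TL and g, g′ are (one-sided suffices) inverses of L, L′ then
   g′T = Tg: THE step behind (3.33a)/(3.34b); `adj_intertwine` — if Q′(U^u)T = SQ′(U) ((3.32)) and T, S preserve the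
   scalar products with T onto, then Q′\*(U^u)S = TQ′\*(U): the covariance of the ADJOINT needs R(u) ORTHOGONAL (located:
   implicit in print, as already in "(3.30) or J^u = R(u)J"); `intertwine_of_quadForm` — the printed "hence" of
   (3.30)/(3.31): equality of the quadratic forms ⟨Tλ, Δ′Tλ⟩ = ⟨λ, Δλ⟩ for symmetric Δ, Δ′ and orthogonal onto T gives
   Δ′T = TΔ (polarization).
2. (3.33) (§2): from (3.31) Δ′ T = T Δ and (3.32b) (Q′\*aQ′)′T = T(Q′\*aQ′): `lapA_intertwine` (Δ′_a covariant),
   `g_intertwine` **(3.33a)** G′(U^u)R(u) = R(u)G′(U); with (3.32a) and orthogonality: `qs_intertwine`, `qggqs_intertwine`,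
   `c_intertwine` ((Q′G′²Q′\*)^{−1} covariant), `R_intertwine` **(3.33b)** by the formula (3.25); and INDEPENDENTLY
   `R_intertwine'`: (3.33b) from (3.31) + (3.32a) + R(u) orthogonal on L²(Ω₀, 𝔤) + R(u(·)) injective ALONE, via the
   (3.21) characterisation of R as the orthogonal projection onto Δ^η_U N(Q′) (`B9Eq325Proj`) and the new uniqueness
   lemma `R325_eq_of_mem_of_orth` — the a-, G′-, (Q′G′²Q′\*)^{−1}-covariances are not needed for R.
3. (3.26)/(3.34) (§3): `lapFull` = Δ_a = Δ + DRD\* + Q\*aQ; `lapFull_intertwine` **(3.34a)** from (3.30) (Δ^η covariant),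
   D and D\* covariant, (3.33b), and "(3.32) again" ((Q\*aQ)′T₁ = T₁(Q\*aQ)); `G_intertwine` **(3.34b)**; `Ds_intertwine`
   (D\* covariance from D covariance + orthogonality, as for Q′\*).
4. THE p. 398 MECHANISM (§4, lattice level, fibre V = 𝔤 with an invariant scalar product, R(u(x)) ∈ O(V)): for a
   gauge family u : X → (V ≃ₗᵢ V), `gaugeAct` (R(u)λ)(x) = R(u(x))λ(x) and a kernel operator `kerOp K`,
   `gaugeAct_kerOp`: R(u)·K·R(u)^{−1} has kernel R(u(x))K(x, y)R(u(y))^{−1} (`kerConj`); `norm_kerConj`: its fibrewise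
   operator norms equal those of K; `norm_gaugeAct`, `inner_gaugeAct_sum`: |R(u)λ|(x) = |λ|(x), ⟨R(u)λ, R(u)μ⟩ = ⟨λ, μ⟩;
   hence `kernel_bound_iff`: a pointwise kernel bound |K(x, y)| ≤ b(x, y) holds for K iff for the conjugated kernel —
   "All these inequalities are invariant with respect to gauge transformations of U" for bounds of the (3.42)/(3.48)
   shape.  (B9's |·| is the normalised Hilbert–Schmidt norm, D-B9-1, likewise unitarily invariant; the operator norm is
   the instance Mathlib provides.)
NOT HERE: the definitions (3.12)/(3.19) of Δ^η(U), Q′_j(U), Q_j(U) and the verification of (3.29)–(3.32) from them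
(hypotheses, as printed: "the gauge invariance of the action (3.1) implies"), existence of the inverses (Thm 3.11),
the Hölder norms (3.40) with parallel transport (G-B9-14 prose), the existence half of `GaugeReduction335` (the gauge
u with U^u = e^{iηA} on □).  Elementary; [folklore] on the algebra, [cite:] on the transcribed laws.  Cell records:
GAPS C-B9-28, DIVERGENCE D-b09.19. -/

namespace Literature.MathematicalPhysics.QuantumFieldTheory.Balaban1983to89.B9Eq333Cov

open B9Eq325Proj

/-! ## §1  Generic intertwining lemmas -/

section Generic

variable {E F : Type*} [NormedAddCommGroup E] [InnerProductSpace ℝ E] [NormedAddCommGroup F]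
  [InnerProductSpace ℝ F]

/-- Intertwining form vs the printed conjugation: for invertible T, X′T = TX ⟺ X′ = TXT^{−1}
("X(U^u) = R(u)X(U)R(u^{−1})"). [folklore] -/
theorem intertwine_iff_conj (X X' : E →ₗ[ℝ] E) (T : E ≃ₗ[ℝ] E) :
    (∀ x, X' (T x) = T (X x)) ↔ ∀ y, X' y = T (X (T.symm y)) := by
  constructor
  · intro h y
    rw [← h (T.symm y), LinearEquiv.apply_symm_apply]
  · intro h x
    rw [h (T x), LinearEquiv.symm_apply_apply]

/-- THE step behind (3.33a) and (3.34b): if L′ intertwines with L through T (L′T = TL), g is a right inverse of L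
and g′ a left inverse of L′, then g′T = Tg — "G′(U^u) = R(u)G′(U)R(u^{−1})" from "Δ′_a(U^u) = R(u)Δ′_a(U)R(u^{−1})".
Pure composition algebra (no linearity, no invertibility of T). [folklore] -/
theorem inverse_intertwine {α : Type*} {L L' g g' T : α → α} (hLT : ∀ x, L' (T x) = T (L x))
    (hg : ∀ x, L (g x) = x) (hg' : ∀ y, g' (L' y) = y) (x : α) : g' (T x) = T (g x) := by
  have h1 := hg' (T (g x))
  rw [hLT, hg] at h1
  exact h1

/-- Covariance of an ADJOINT: if Q′(U^u)T = SQ′(U) ((3.32)), Q′\* is the adjoint of Q′ in both systems, T and S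
preserve the scalar products and T is onto, then Q′\*(U^u)S = TQ′\*(U).  This is where ORTHOGONALITY of R(u) enters
(implicit in print; cf. "(3.30) … or J^u = R(u)J"). [folklore] -/
theorem adj_intertwine {q q' : E →ₗ[ℝ] F} {qs qs' : F →ₗ[ℝ] E} {T : E →ₗ[ℝ] E} {S : F →ₗ[ℝ] F}
    (hadj : ∀ (x : E) (φ : F), inner ℝ (q x) φ = inner ℝ x (qs φ))
    (hadj' : ∀ (x : E) (φ : F), inner ℝ (q' x) φ = inner ℝ x (qs' φ))
    (hT : ∀ x y : E, inner ℝ (T x) (T y) = inner ℝ x y) (hS : ∀ φ ψ : F, inner ℝ (S φ) (S ψ) = inner ℝ φ ψ)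
    (hTs : Function.Surjective T) (h32 : ∀ x, q' (T x) = S (q x)) (φ : F) : qs' (S φ) = T (qs φ) := by
  have key : ∀ x : E, inner ℝ (T x) (qs' (S φ) - T (qs φ)) = 0 := by
    intro x
    rw [inner_sub_right, ← hadj', h32, hS, hadj, hT, sub_self]
  obtain ⟨x, hx⟩ := hTs (qs' (S φ) - T (qs φ))
  have h0 := key x
  rw [hx] at h0
  exact sub_eq_zero.mp (inner_self_eq_zero.mp h0)

/-- The printed "hence" of (3.30)/(3.31): for symmetric Δ, Δ′ and a scalar-product preserving onto T, equality of the
quadratic forms ⟨Tλ, Δ′Tλ⟩ = ⟨λ, Δλ⟩ gives the operator law Δ′T = TΔ ("⟨R(u)λ, Δ^η_{U^u}R(u)λ⟩ = ⟨λ, Δ^η_U λ⟩, hence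
Δ^η_{U^u} = R(u)Δ^η_U R(u^{−1})") — polarization + orthogonality. [cite: Balaban1985BackgroundPropagators, (3.30)-(3.31) p.395] -/
theorem intertwine_of_quadForm {Δ Δ' T : E →ₗ[ℝ] E} (hΔ : ∀ x y : E, inner ℝ (Δ x) y = inner ℝ x (Δ y))
    (hΔ' : ∀ x y : E, inner ℝ (Δ' x) y = inner ℝ x (Δ' y))
    (hT : ∀ x y : E, inner ℝ (T x) (T y) = inner ℝ x y) (hTs : Function.Surjective T)
    (h30 : ∀ x : E, inner ℝ (T x) (Δ' (T x)) = inner ℝ x (Δ x)) (y : E) : Δ' (T y) = T (Δ y) := by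
  have key : ∀ x y : E, inner ℝ (T x) (Δ' (T y)) = inner ℝ x (Δ y) := by
    intro x y
    have e1 := h30 (x + y)
    have e2 := h30 x
    have e3 := h30 y
    simp only [map_add, inner_add_left, inner_add_right] at e1
    have s1 : inner ℝ (T y) (Δ' (T x)) = inner ℝ (T x) (Δ' (T y)) := by rw [real_inner_comm, hΔ']
    have s2 : inner ℝ y (Δ x) = inner ℝ x (Δ y) := by rw [real_inner_comm, hΔ]
    linarith
  have h0 : ∀ x : E, inner ℝ (T x) (Δ' (T y) - T (Δ y)) = 0 := by
    intro x
    rw [inner_sub_right, key, hT, sub_self]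
  obtain ⟨x, hx⟩ := hTs (Δ' (T y) - T (Δ y))
  have h1 := h0 x
  rw [hx] at h1
  exact sub_eq_zero.mp (inner_self_eq_zero.mp h1)

/-- Uniqueness of the orthogonal decomposition for the (3.25) operator (algebraic twin of Mathlib's
`Submodule.eq_starProjection_of_mem_of_inner_eq_zero`, no completeness needed): if v ∈ Δ^η_U N(Q′) and u − v ⊥ Δ^η_U N(Q′)
then Ru = v. [folklore] -/
theorem R325_eq_of_mem_of_orth {Δ : E →ₗ[ℝ] E} {q : E →ₗ[ℝ] F} {qs : F →ₗ[ℝ] E} {A : F →ₗ[ℝ] F} {g : E →ₗ[ℝ] E}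
    {c : F →ₗ[ℝ] F} (h : Data Δ q qs A g c) {u v : E} (hv : v ∈ lapKer Δ q)
    (horth : ∀ w ∈ lapKer Δ q, inner ℝ (u - v) w = 0) : R325 q qs g c u = v := by
  have h1 : R325 q qs g c v = v := (h.R325_fix_iff_mem v).mpr hv
  have h2 : R325 q qs g c (u - v) = 0 := by
    have h0 : inner ℝ (R325 q qs g c (u - v)) (R325 q qs g c (u - v)) = 0 := by
      rw [← h.R325_symm, h.R325_idem, real_inner_comm]
      exact horth _ (h.R325_mem (u - v))
    exact inner_self_eq_zero.mp h0
  have h3 : u = v + (u - v) := by abel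
  rw [h3, map_add, h1, h2, add_zero]

end Generic

/-! ## §2  (3.31), (3.32) "imply further" (3.33) -/

section Sect3

variable {E F : Type*} [NormedAddCommGroup E] [InnerProductSpace ℝ E] [NormedAddCommGroup F]
  [InnerProductSpace ℝ F]
variable {Δ Δ' : E →ₗ[ℝ] E} {q q' : E →ₗ[ℝ] F} {qs qs' : F →ₗ[ℝ] E} {A A' : F →ₗ[ℝ] F} {g g' : E →ₗ[ℝ] E}
  {c c' : F →ₗ[ℝ] F} {T : E →ₗ[ℝ] E} {S : F →ₗ[ℝ] F}

/-- Δ′_a is covariant: from (3.31) Δ^η_{U^u}R(u) = R(u)Δ^η_U and (3.32b) (Q′\*aQ′)(U^u)R(u) = R(u)(Q′\*aQ′)(U).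
[cite: Balaban1985BackgroundPropagators, (3.31)-(3.32) p.395] -/
theorem lapA_intertwine (h31 : ∀ x, Δ' (T x) = T (Δ x)) (h32b : ∀ x, qs' (A' (q' (T x))) = T (qs (A (q x))))
    (x : E) : lapA Δ' q' qs' A' (T x) = T (lapA Δ q qs A x) := by
  rw [lapA_apply, lapA_apply, h31, h32b, map_add]

/-- **(3.33a)** "G′(U^u) = R(u)G′(U)R(u^{−1})" in intertwining form, from (3.31), (3.32b) and the inverse relations of
the two systems. [cite: Balaban1985BackgroundPropagators, (3.33) p.396] -/
theorem g_intertwine (h : Data Δ q qs A g c) (h' : Data Δ' q' qs' A' g' c') (h31 : ∀ x, Δ' (T x) = T (Δ x))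
    (h32b : ∀ x, qs' (A' (q' (T x))) = T (qs (A (q x)))) (x : E) : g' (T x) = T (g x) :=
  inverse_intertwine (L := fun x => lapA Δ q qs A x) (L' := fun x => lapA Δ' q' qs' A' x)
    (fun x => lapA_intertwine h31 h32b x) h.g_right h'.g_left x

/-- Q′\* is covariant, from (3.32a) Q′(U^u)R(u) = R(u(·))Q′(U), the adjoint relations and ORTHOGONALITY of R(u),
R(u(·)) (R(u) onto). [folklore] -/
theorem qs_intertwine (h : Data Δ q qs A g c) (h' : Data Δ' q' qs' A' g' c')
    (hT : ∀ x y : E, inner ℝ (T x) (T y) = inner ℝ x y) (hS : ∀ φ ψ : F, inner ℝ (S φ) (S ψ) = inner ℝ φ ψ)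
    (hTs : Function.Surjective T) (h32a : ∀ x, q' (T x) = S (q x)) (φ : F) : qs' (S φ) = T (qs φ) :=
  adj_intertwine h.adj h'.adj hT hS hTs h32a φ

/-- Q′G′²Q′\* is covariant (through R(u(·)) on L²(𝔅)). [folklore] -/
theorem qggqs_intertwine (h : Data Δ q qs A g c) (h' : Data Δ' q' qs' A' g' c') (h31 : ∀ x, Δ' (T x) = T (Δ x))
    (h32a : ∀ x, q' (T x) = S (q x)) (h32b : ∀ x, qs' (A' (q' (T x))) = T (qs (A (q x))))
    (hT : ∀ x y : E, inner ℝ (T x) (T y) = inner ℝ x y) (hS : ∀ φ ψ : F, inner ℝ (S φ) (S ψ) = inner ℝ φ ψ)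
    (hTs : Function.Surjective T) (φ : F) : q' (g' (g' (qs' (S φ)))) = S (q (g (g (qs φ)))) := by
  rw [qs_intertwine h h' hT hS hTs h32a, g_intertwine h h' h31 h32b, g_intertwine h h' h31 h32b, h32a]

/-- (Q′G′²Q′\*)^{−1} is covariant (inverse of a covariant operator). [folklore] -/
theorem c_intertwine (h : Data Δ q qs A g c) (h' : Data Δ' q' qs' A' g' c') (h31 : ∀ x, Δ' (T x) = T (Δ x))
    (h32a : ∀ x, q' (T x) = S (q x)) (h32b : ∀ x, qs' (A' (q' (T x))) = T (qs (A (q x))))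
    (hT : ∀ x y : E, inner ℝ (T x) (T y) = inner ℝ x y) (hS : ∀ φ ψ : F, inner ℝ (S φ) (S ψ) = inner ℝ φ ψ)
    (hTs : Function.Surjective T) (φ : F) : c' (S φ) = S (c φ) :=
  inverse_intertwine (L := fun φ => q (g (g (qs φ)))) (L' := fun φ => q' (g' (g' (qs' φ))))
    (fun φ => qggqs_intertwine h h' h31 h32a h32b hT hS hTs φ) h.c_right h'.c_left φ

/-- **(3.33b)** "R(U^u) = R(u)R(U)R(u^{−1})" by the FORMULA (3.25): every factor of I − G′Q′\*(Q′G′²Q′\*)^{−1}Q′G′ is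
covariant.  Uses (3.31), both halves of (3.32), and orthogonality of R(u), R(u(·)).
[cite: Balaban1985BackgroundPropagators, (3.33) p.396] -/
theorem R_intertwine (h : Data Δ q qs A g c) (h' : Data Δ' q' qs' A' g' c') (h31 : ∀ x, Δ' (T x) = T (Δ x))
    (h32a : ∀ x, q' (T x) = S (q x)) (h32b : ∀ x, qs' (A' (q' (T x))) = T (qs (A (q x))))
    (hT : ∀ x y : E, inner ℝ (T x) (T y) = inner ℝ x y) (hS : ∀ φ ψ : F, inner ℝ (S φ) (S ψ) = inner ℝ φ ψ)
    (hTs : Function.Surjective T) (f : E) : R325 q' qs' g' c' (T f) = T (R325 q qs g c f) := by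
  rw [R325_apply, R325_apply, g_intertwine h h' h31 h32b, h32a, c_intertwine h h' h31 h32a h32b hT hS hTs,
    qs_intertwine h h' hT hS hTs h32a, g_intertwine h h' h31 h32b, map_sub]

/-- N(Q′(U^u)) ∋ R(u)λ ⟺ λ ∈ N(Q′(U)), when R(u(·)) is injective. [folklore] -/
theorem ker_iff (h32a : ∀ x, q' (T x) = S (q x)) (hSi : Function.Injective S) (l : E) :
    q' (T l) = 0 ↔ q l = 0 := by
  rw [h32a]
  constructor
  · intro h0
    exact hSi (by rw [h0, map_zero])
  · intro h0
    rw [h0, map_zero]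

/-- R(u) maps Δ^η_U N(Q′(U)) into Δ^η_{U^u} N(Q′(U^u)). [folklore] -/
theorem mem_lapKer_of_intertwine (h31 : ∀ x, Δ' (T x) = T (Δ x)) (h32a : ∀ x, q' (T x) = S (q x))
    (hSi : Function.Injective S) {ω : E} (hω : ω ∈ lapKer Δ q) : T ω ∈ lapKer Δ' q' := by
  rw [mem_lapKer] at hω ⊢
  obtain ⟨l, hl, rfl⟩ := hω
  exact ⟨T l, (ker_iff h32a hSi l).mpr hl, (h31 l).symm⟩

/-- … and ONTO it, when R(u) is onto. [folklore] -/
theorem exists_of_mem_lapKer (h31 : ∀ x, Δ' (T x) = T (Δ x)) (h32a : ∀ x, q' (T x) = S (q x))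
    (hSi : Function.Injective S) (hTs : Function.Surjective T) {ω' : E} (hω' : ω' ∈ lapKer Δ' q') :
    ∃ ω ∈ lapKer Δ q, ω' = T ω := by
  rw [mem_lapKer] at hω'
  obtain ⟨l', hl', rfl⟩ := hω'
  obtain ⟨l, rfl⟩ := hTs l'
  refine ⟨Δ l, (mem_lapKer Δ q _).mpr ⟨l, (ker_iff h32a hSi l).mp hl', rfl⟩, h31 l⟩

/-- **(3.33b) AGAIN, from less**: R(U^u)R(u) = R(u)R(U) follows from (3.31), (3.32a), orthogonality of R(u) on
L²(Ω₀, 𝔤) (onto) and injectivity of R(u(·)) ALONE — via (3.21): R is the orthogonal projection onto Δ^η_U N(Q′) and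
R(u) maps Δ^η_U N(Q′(U)) onto Δ^η_{U^u} N(Q′(U^u)).  No covariance of a, G′ or (Q′G′²Q′\*)^{−1} is used.
[cite: Balaban1985BackgroundPropagators, (3.33) p.396 with (3.21) p.394] -/
theorem R_intertwine' (h : Data Δ q qs A g c) (h' : Data Δ' q' qs' A' g' c') (h31 : ∀ x, Δ' (T x) = T (Δ x))
    (h32a : ∀ x, q' (T x) = S (q x)) (hT : ∀ x y : E, inner ℝ (T x) (T y) = inner ℝ x y)
    (hTs : Function.Surjective T) (hSi : Function.Injective S) (f : E) :
    R325 q' qs' g' c' (T f) = T (R325 q qs g c f) := by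
  apply R325_eq_of_mem_of_orth h' (mem_lapKer_of_intertwine h31 h32a hSi (h.R325_mem f))
  intro w hw
  obtain ⟨ω, hω, rfl⟩ := exists_of_mem_lapKer h31 h32a hSi hTs hw
  rw [← map_sub, hT]
  exact h.inner_sub_R325 f ω hω

end Sect3

/-! ## §3  (3.26) and "This implies the transformation laws for the operators Δ_a and G (3.34)" -/

section Sect34

variable {E F₁ E₁ : Type*} [NormedAddCommGroup E] [InnerProductSpace ℝ E] [NormedAddCommGroup F₁]
  [InnerProductSpace ℝ F₁] [NormedAddCommGroup E₁] [InnerProductSpace ℝ E₁]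

/-- **(3.26)** "Δ_a = Δ + DRD\* + Q\*aQ" on the vector fields E₁: Δ₁ = Δ^η(U), D = D^η_U : E → E₁, Ds = D^η\*_U,
R = R(U) on E, Q = Q(U) : E₁ → F₁, Qs = Q\*(U), B = a. [cite: Balaban1985BackgroundPropagators, (3.26) p.395] -/
def lapFull (Δ₁ : E₁ →ₗ[ℝ] E₁) (D : E →ₗ[ℝ] E₁) (Ds : E₁ →ₗ[ℝ] E) (R : E →ₗ[ℝ] E) (Q : E₁ →ₗ[ℝ] F₁)
    (Qs : F₁ →ₗ[ℝ] E₁) (B : F₁ →ₗ[ℝ] F₁) : E₁ →ₗ[ℝ] E₁ :=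
  Δ₁ + D ∘ₗ R ∘ₗ Ds + Qs ∘ₗ B ∘ₗ Q

/-- Unfolding of (3.26). [folklore] -/
theorem lapFull_apply (Δ₁ : E₁ →ₗ[ℝ] E₁) (D : E →ₗ[ℝ] E₁) (Ds : E₁ →ₗ[ℝ] E) (R : E →ₗ[ℝ] E)
    (Q : E₁ →ₗ[ℝ] F₁) (Qs : F₁ →ₗ[ℝ] E₁) (B : F₁ →ₗ[ℝ] F₁) (v : E₁) :
    lapFull Δ₁ D Ds R Q Qs B v = Δ₁ v + D (R (Ds v)) + Qs (B (Q v)) := rfl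

variable {Δ₁ Δ₁' : E₁ →ₗ[ℝ] E₁} {D D' : E →ₗ[ℝ] E₁} {Ds Ds' : E₁ →ₗ[ℝ] E} {R R' : E →ₗ[ℝ] E}
  {Q Q' : E₁ →ₗ[ℝ] F₁} {Qs Qs' : F₁ →ₗ[ℝ] E₁} {B B' : F₁ →ₗ[ℝ] F₁} {G G' : E₁ →ₗ[ℝ] E₁}
  {T : E →ₗ[ℝ] E} {T₁ : E₁ →ₗ[ℝ] E₁} {S₁ : F₁ →ₗ[ℝ] F₁}

/-- D^η\*_U is covariant, from the covariance of D^η_U, the adjoint relations and orthogonality of R(u) on E (onto)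
and on E₁. [folklore] -/
theorem Ds_intertwine (hadj : ∀ (x : E) (v : E₁), inner ℝ (D x) v = inner ℝ x (Ds v))
    (hadj' : ∀ (x : E) (v : E₁), inner ℝ (D' x) v = inner ℝ x (Ds' v))
    (hT : ∀ x y : E, inner ℝ (T x) (T y) = inner ℝ x y) (hT₁ : ∀ v w : E₁, inner ℝ (T₁ v) (T₁ w) = inner ℝ v w)
    (hTs : Function.Surjective T) (hD : ∀ x, D' (T x) = T₁ (D x)) (v : E₁) : Ds' (T₁ v) = T (Ds v) :=
  adj_intertwine hadj hadj' hT hT₁ hTs hD v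

/-- **(3.34a)** "Δ_a(U^u) = R(u)Δ_a(U)R(u^{−1})" in intertwining form, from (3.30) (Δ^η covariant), the covariance
of D^η_U and D^η\*_U, (3.33b) (R covariant) and "(3.32) again" ((Q\*aQ)(U^u)R(u) = R(u)(Q\*aQ)(U)).
[cite: Balaban1985BackgroundPropagators, (3.34) p.396] -/
theorem lapFull_intertwine (h30 : ∀ v, Δ₁' (T₁ v) = T₁ (Δ₁ v)) (hD : ∀ x, D' (T x) = T₁ (D x))
    (hDs : ∀ v, Ds' (T₁ v) = T (Ds v)) (h33 : ∀ x, R' (T x) = T (R x))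
    (h32c : ∀ v, Qs' (B' (Q' (T₁ v))) = T₁ (Qs (B (Q v)))) (v : E₁) :
    lapFull Δ₁' D' Ds' R' Q' Qs' B' (T₁ v) = T₁ (lapFull Δ₁ D Ds R Q Qs B v) := by
  rw [lapFull_apply, lapFull_apply, h30, hDs, h33, hD, h32c, map_add, map_add]

/-- **(3.34b)** "G(U^u) = R(u)G(U)R(u^{−1})" in intertwining form: G = (Δ_a↾Ω₀)^{−1} (right inverse at U, left
inverse at U^u suffice). [cite: Balaban1985BackgroundPropagators, (3.34) p.396] -/
theorem G_intertwine (hG : ∀ v, lapFull Δ₁ D Ds R Q Qs B (G v) = v)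
    (hG' : ∀ v, G' (lapFull Δ₁' D' Ds' R' Q' Qs' B' v) = v) (h30 : ∀ v, Δ₁' (T₁ v) = T₁ (Δ₁ v))
    (hD : ∀ x, D' (T x) = T₁ (D x)) (hDs : ∀ v, Ds' (T₁ v) = T (Ds v)) (h33 : ∀ x, R' (T x) = T (R x))
    (h32c : ∀ v, Qs' (B' (Q' (T₁ v))) = T₁ (Qs (B (Q v)))) (v : E₁) : G' (T₁ v) = T₁ (G v) :=
  inverse_intertwine (L := fun v => lapFull Δ₁ D Ds R Q Qs B v) (L' := fun v => lapFull Δ₁' D' Ds' R' Q' Qs' B' v)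
    (fun v => lapFull_intertwine h30 hD hDs h33 h32c v) hG hG' v

end Sect34

/-! ## §4  The p. 398 mechanism: conjugated kernels and pointwise isometries -/

section Fibre

variable {X : Type*} {V : Type*} [NormedAddCommGroup V] [InnerProductSpace ℝ V]

/-- (R(u)λ)(x) = R(u(x))λ(x): the gauge transformation acting on 𝔤-valued lattice functions, R(u(x)) an isometry of
the fibre (the adjoint action preserves the invariant scalar product). [cite: Balaban1985BackgroundPropagators, (3.28)-(3.32) p.395] -/
def gaugeAct (u : X → V ≃ₗᵢ[ℝ] V) (lam : X → V) : X → V := fun x => u x (lam x)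

/-- A kernel operator (Kλ)(x) = Σ_y K(x, y)λ(y) with End(𝔤)-valued kernel. [folklore] -/
def kerOp [Fintype X] (K : X → X → V →L[ℝ] V) (lam : X → V) : X → V := fun x => ∑ y, K x y (lam y)

/-- The conjugated kernel R(u(x))K(x, y)R(u(y))^{−1}. [folklore] -/
def kerConj (u : X → V ≃ₗᵢ[ℝ] V) (K : X → X → V →L[ℝ] V) : X → X → V →L[ℝ] V := fun x y =>
  (u x).toLinearIsometry.toContinuousLinearMap.comp ((K x y).comp (u y).symm.toLinearIsometry.toContinuousLinearMap)

/-- Unfolding of `kerConj`. [folklore] -/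
theorem kerConj_apply (u : X → V ≃ₗᵢ[ℝ] V) (K : X → X → V →L[ℝ] V) (x y : X) (w : V) :
    kerConj u K x y w = u x (K x y ((u y).symm w)) := rfl

/-- R(u)KR(u)^{−1} HAS KERNEL R(u(x))K(x, y)R(u(y))^{−1}: R(u)(Kλ) = (kerConj u K)(R(u)λ) — the lattice content of
"G′(U^u) = R(u)G′(U)R(u^{−1})" for the kernels G′(U; x, y). [folklore] -/
theorem gaugeAct_kerOp [Fintype X] (u : X → V ≃ₗᵢ[ℝ] V) (K : X → X → V →L[ℝ] V) (lam : X → V) :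
    gaugeAct u (kerOp K lam) = kerOp (kerConj u K) (gaugeAct u lam) := by
  funext x
  simp only [gaugeAct, kerOp, kerConj_apply, LinearIsometryEquiv.symm_apply_apply, map_sum]

/-- The conjugated kernel has the SAME fibrewise operator norms (unitary invariance).
[cite: Balaban1985BackgroundPropagators, p.398 (after (3.47))] -/
theorem norm_kerConj (u : X → V ≃ₗᵢ[ℝ] V) (K : X → X → V →L[ℝ] V) (x y : X) : ‖kerConj u K x y‖ = ‖K x y‖ := by
  rw [kerConj, LinearIsometry.norm_toContinuousLinearMap_comp]
  exact ContinuousLinearMap.opNorm_comp_linearIsometryEquiv (K x y) (u y).symm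

/-- |R(u)λ|(x) = |λ|(x) pointwise (so every sup / weighted sup norm of λ is gauge invariant). [folklore] -/
theorem norm_gaugeAct (u : X → V ≃ₗᵢ[ℝ] V) (lam : X → V) (x : X) : ‖gaugeAct u lam x‖ = ‖lam x‖ :=
  (u x).norm_map (lam x)

/-- ⟨R(u)λ, R(u)μ⟩ = ⟨λ, μ⟩ for the lattice scalar product with any site weights w(x) (e.g. η^d): R(u) is orthogonal
on L²(Ω₀, 𝔤) — the hypothesis `hT` of §§1–3. [folklore] -/
theorem inner_gaugeAct_sum [Fintype X] (u : X → V ≃ₗᵢ[ℝ] V) (w : X → ℝ) (lam mu : X → V) :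
    ∑ x, w x * inner ℝ (gaugeAct u lam x) (gaugeAct u mu x) = ∑ x, w x * inner ℝ (lam x) (mu x) := by
  simp only [gaugeAct, LinearIsometryEquiv.inner_map_map]

/-- R(u) is invertible on lattice functions: R(u^{−1}) undoes it. [folklore] -/
theorem gaugeAct_symm_apply (u : X → V ≃ₗᵢ[ℝ] V) (lam : X → V) :
    gaugeAct (fun x => (u x).symm) (gaugeAct u lam) = lam := by
  funext x
  simp only [gaugeAct, LinearIsometryEquiv.symm_apply_apply]

/-- "All these inequalities are invariant with respect to gauge transformations of U" for pointwise kernel bounds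
of the (3.42)/(3.48) shape |K(x, y)| ≤ b(x, y) (b = B₀e^{−δ₀|x−y|}, …): the bound holds for the kernel at U iff it
holds for the conjugated kernel at U^u. [cite: Balaban1985BackgroundPropagators, p.398 (after (3.47)); Cor. 3.6 proof p.408] -/
theorem kernel_bound_iff (u : X → V ≃ₗᵢ[ℝ] V) (K : X → X → V →L[ℝ] V) (b : X → X → ℝ) :
    (∀ x y, ‖kerConj u K x y‖ ≤ b x y) ↔ ∀ x y, ‖K x y‖ ≤ b x y := by
  simp only [norm_kerConj]

/-- … and for pointwise bounds on transformed functions |(Kλ)(x)| ≤ b(x): (R(u)KR(u)^{−1})(R(u)λ) obeys the bound iff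
Kλ does. [folklore] -/
theorem apply_bound_iff [Fintype X] (u : X → V ≃ₗᵢ[ℝ] V) (K : X → X → V →L[ℝ] V) (lam : X → V) (b : X → ℝ) :
    (∀ x, ‖kerOp (kerConj u K) (gaugeAct u lam) x‖ ≤ b x) ↔ ∀ x, ‖kerOp K lam x‖ ≤ b x := by
  simp only [← gaugeAct_kerOp, norm_gaugeAct]

end Fibre

end Literature.MathematicalPhysics.QuantumFieldTheory.Balaban1983to89.B9Eq333Cov
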